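import Summits.QuantumFields.YangMills.Theorems.BalabanUVNodesN08AlphaRegSel

/-!
# Route «BalabanUVNodes», Track-A DAG node N08 = [Balaban1985UV3] — THE (α) CLAUSE: the in-edge schema `InEdgeFaces₃` from TWO IN-EDGE
# CONCLUSIONS — [7] Thm 1 (8) (existence of a (42)-minimiser in the regular class) and [4] §1–2 (continuity of the `k`-fold average on it)

Cell `pub-ymgap`, seat `pub-ymgap-dag-n08-d` gen 4, file 3 (director-ym R134 row «CLASS-I in-edge conclusions at the (α) granularity of `RunAlpha` …
discharge the species-OK interfaces `h68 ∕ hU ∕ h44 ∕ hLF67`»).  `bears_on: R4∕N08`; filed `--supports stmt-QuantumFields-19903 --as helper`.  Sorry-free,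
standard axioms.  Builds on this seat's files 1a `…N08AlphaGroupTopology` (`rhoTopology 𝔊`), 1b `…N08AlphaMeasUk` (Castaing∕KRN selection at a group as
printed) and 2 `…N08AlphaRegSel` (`regClass 𝔊 𝔠 k h` = [7] (2)∕(8)'s class over the `Ω_j(h)`, OPEN and ∋ `1`; `measUk` ∧ `reg2` outright for
minimiser-selected external inputs; `InEdgeFaces₃ ⇐ inB42`).

THE LAST FACE.  `inB42` asks that the `j`-fold averages (42)–(43) of [4] of the lift of `U_k(h, U)`, `j < k`, agree on the bonds of `Λ_j(h)` with SOME
`h`-large field history (`InB42Lift … (liftCfg 𝔊 (X.UkH k h U)) V ∧ HLarge h V`).  So the selection of files 1b∕2 must be run with THE LIFT AVERAGE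
`U ↦ (Ū^j)_{j<k}` as the constraint map and `h`-large data `Vl k h`.  That map is continuous only ON the regular class (the logarithmic series (21) of
[4] converges on small loop variables — [4] Props. 1–2); §1 therefore extends the selection theorem to constraint maps CONTINUOUS ON THE OPEN CLASS
(patching by a constant off the class keeps σ-closed-continuity: `sigmaClosedContinuous_piecewise`), §2 is the abstract glue «per-(k, h) measurable
selectors ⇒ external inputs» (the pattern of file 1b's `exists_externalInputs_measUk`, for ANY admissible-set family), §3 the (42)-problem the face
reads: `admB42 … k h V = {U ∈ regClass k h | Ū^j(lift U) = (Vl k h)_j on Λ_j(h), j < k, and T_k U = V on B_k}` (the top clause «V_k = V» through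
any map `T_k` continuous on the class — e.g. a `k`-fold torus average), and §4 the END of this seat's reduction:
★ `exists_externalInputs_faces₃`: for h-large data and the two IN-EDGE CONCLUSIONS displayed as hypotheses —
  (b7) `hcont`: the lift averages `U ↦ Ū^j(lift U)(z, κ)` AT THE BONDS OF `Λ_j(h)`, `j < k`, (and `T_k`) are continuous on `regClass 𝔊 𝔠 k h`
  in the topology of the realisation ([Balaban1985Averaging] Props. 1–2 + the series (21) on small loop variables: in-edge b7);
  (b11) `hsolv`: for `k ≤ K`, admissible `h` and every `V` the problem `admB42 … k h V` HAS a minimiser of `A` ([Balaban1985Variational] Thm 1 (8):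
  in-edge b11) —
  there are external inputs `X` (same `av`, `reg` as any given `X₀`) with `measUk` (all `k, h`), `reg2` (all `k ≤ K`), `inB42`, hence
  `InEdgeFaces₃ 𝔊 𝔠 X`; with gen 2∕3 (`BalabanUVNodesN08AlphaThreeFaces`) the (α) clause's in-edge side is thereby reduced to (b7) + (b11) BY NAME
  of their content.
HONEST FRAMING.  (b7), (b11) are DISPLAYED, not proved; nothing of [B10] ∕ [7] ∕ [4] is asserted; count-neutral; NOT a discharge of N08.  d = 3 lattice
gauge theory on finite tori as printed; nothing about d = 4, the continuum, OS axioms, a mass gap or the Clay problem.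
-/

noncomputable section

namespace Summit.QuantumFields.YangMills.Theorems.BalabanUVNodesN08AlphaInB42Sel

open MeasureTheory Set Topology TopologicalSpace
open scoped Matrix Matrix.Norms.L2Operator
open Literature.MeasureTheory.RandomSets
open Literature.MathematicalPhysics.QuantumFieldTheory.Balaban1983to89
open Literature.MathematicalPhysics.QuantumFieldTheory.Balaban1983to89.B10 (pFun)
open Literature.MathematicalPhysics.QuantumFieldTheory.Balaban1985CMP102.Setting
open Summit.QuantumFields.Balaban3D.Carriers
open Summit.QuantumFields.Balaban3D.Proofs.Primitives (AlphaConsts)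
open Summit.QuantumFields.Balaban3D.Proofs.LiftBridge (liftCfg)
open Summit.QuantumFields.Balaban3D.Proofs.TorusLift (projSite)
open Summit.QuantumFields.YangMills.Theorems.BalabanUVNodesN08AlphaClassI (RegLift InB42Lift HLarge)
open Summit.QuantumFields.YangMills.Theorems.BalabanUVNodesN08AlphaLoop28 (InEdgeFaces₃)
open Summit.QuantumFields.YangMills.Theorems.BalabanUVNodesN08AlphaGroupTopology
open Summit.QuantumFields.YangMills.Theorems.BalabanUVNodesN08AlphaMeasUk
open Summit.QuantumFields.YangMills.Theorems.BalabanUVNodesN08AlphaRegSel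
open B7Prop1Explicit (e)
open B7Prop2Explicit (avgIter)

variable {L : ℕ}

/-! ## §1 Selection with a constraint map continuous ON the open class -/

section ContinuousOn

open Classical in
/-- A map continuous on an OPEN set `O` of a metrizable space, patched by a constant off `O`, is σ-closed-continuous (pieces: a closed exhaustion of
`O` and `Oᶜ`; `SigmaClosedContinuous.of_isOpen`). [folklore] -/
theorem sigmaClosedContinuous_piecewise {Y Z : Type*} [TopologicalSpace Y] [MetrizableSpace Y] [TopologicalSpace Z] {O : Set Y} (hO : IsOpen O)
    {g : Y → Z} (hg : ContinuousOn g O) (z₀ : Z) : SigmaClosedContinuous (O.piecewise g fun _ => z₀) :=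
  SigmaClosedContinuous.of_isOpen hO (hg.congr (Set.piecewise_eqOn O g _))
    (continuousOn_const.congr (Set.piecewise_eqOn_compl O g _))

open Classical in
/-- **Measurable selection of constrained minimisers, constraint map continuous ON THE OPEN CLASS only** (the tree's
`exists_measurable_constrained_argmin` asks σ-closed-continuity on the whole space; patching `g` by a constant off `O` does not change the admissible
sets `{y ∈ O | (g y, π x) ∈ R}`). [folklore] -/
theorem exists_measurable_constrained_argmin_of_continuousOn {X Y Z : Type*} [MeasurableSpace X] [TopologicalSpace Y] [PolishSpace Y]
    [CompactSpace Y] [MeasurableSpace Y] [BorelSpace Y] [TopologicalSpace Z] [MeasurableSpace Z] [OpensMeasurableSpace Z]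
    {π : X → Z} (hπ : Measurable π) {O : Set Y} (hO : IsOpen O) {g : Y → Z} (hg : ContinuousOn g O) {R : Set (Z × Z)} (hR : IsClosed R)
    {S : Y → ℝ} (hS : Continuous S) (y₀ : Y) :
    ∃ f : X → Y, Measurable f ∧
      (∀ x, (∃ y, (y ∈ O ∧ (g y, π x) ∈ R) ∧ ∀ z, z ∈ O ∧ (g z, π x) ∈ R → S y ≤ S z) →
        (f x ∈ O ∧ (g (f x), π x) ∈ R) ∧ ∀ z, z ∈ O ∧ (g z, π x) ∈ R → S (f x) ≤ S z) ∧
      (∀ x, ¬ (∃ y, (y ∈ O ∧ (g y, π x) ∈ R) ∧ ∀ z, z ∈ O ∧ (g z, π x) ∈ R → S y ≤ S z) → f x = y₀) := by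
  have hg' : SigmaClosedContinuous (O.piecewise g fun _ => g y₀) := sigmaClosedContinuous_piecewise hO hg (g y₀)
  have hiff : ∀ (y : Y) (x : X), (y ∈ O ∧ ((O.piecewise g fun _ => g y₀) y, π x) ∈ R) ↔ (y ∈ O ∧ (g y, π x) ∈ R) := fun y x => by
    constructor
    · rintro ⟨hy, h⟩; exact ⟨hy, by rwa [Set.piecewise_eq_of_mem _ _ _ hy] at h⟩
    · rintro ⟨hy, h⟩; exact ⟨hy, by rwa [Set.piecewise_eq_of_mem _ _ _ hy]⟩
  obtain ⟨f, hfm, hfin, hfout⟩ := exists_measurable_constrained_argmin hπ hg' hO hR hS y₀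
  refine ⟨f, hfm, fun x hx => ?_, fun x hx => ?_⟩
  · obtain ⟨y, hy, hmin⟩ := hx
    have hex := hfin x ⟨y, (hiff y x).mpr hy, fun z hz => hmin z ((hiff z x).mp hz)⟩
    exact ⟨(hiff _ x).mp hex.1, fun z hz => hex.2 z ((hiff z x).mpr hz)⟩
  · refine hfout x fun h => hx ?_
    obtain ⟨y, hy, hmin⟩ := h
    exact ⟨y, (hiff y x).mp hy, fun z hz => hmin z ((hiff z x).mpr hz)⟩

variable {G : Type} [GaugeGroup G] [MeasurableSpace G] (𝔊 : GroupModel G) {P : Params}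

/-- The same AT A GROUP AS PRINTED (configurations `GaugeField P i G`, topology of the realisation). [cite: Balaban1985Variational, Thm 1 p.279 (measurable-selection reading; existence NOT used)] -/
theorem exists_measurable_constrainedMin_rho_of_continuousOn {i : ℕ} {X : Type*} [MeasurableSpace X] {Z : Type*} [TopologicalSpace Z]
    [MeasurableSpace Z] [OpensMeasurableSpace Z] {π : X → Z} (hπ : Measurable π) {O : Set (GaugeField P i G)}
    (hO : letI := rhoTopology 𝔊; IsOpen O) {g : GaugeField P i G → Z} (hg : letI := rhoTopology 𝔊; ContinuousOn g O)
    {R : Set (Z × Z)} (hR : IsClosed R) {A : GaugeField P i G → ℝ} (hA : letI := rhoTopology 𝔊; Continuous A) (U₁ : GaugeField P i G) :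
    ∃ f : X → GaugeField P i G, Measurable f ∧
      (∀ x, (∃ U, (U ∈ O ∧ (g U, π x) ∈ R) ∧ ∀ U', U' ∈ O ∧ (g U', π x) ∈ R → A U ≤ A U') →
        (f x ∈ O ∧ (g (f x), π x) ∈ R) ∧ ∀ U', U' ∈ O ∧ (g U', π x) ∈ R → A (f x) ≤ A U') ∧
      (∀ x, ¬ (∃ U, (U ∈ O ∧ (g U, π x) ∈ R) ∧ ∀ U', U' ∈ O ∧ (g U', π x) ∈ R → A U ≤ A U') → f x = U₁) := by
  letI := rhoTopology 𝔊
  haveI := compactSpace_rho 𝔊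
  haveI := secondCountableTopology_rho 𝔊
  haveI := polishSpace_rho 𝔊
  haveI := borelSpace_rho 𝔊
  haveI : CompactSpace (GaugeField P i G) := inferInstanceAs (CompactSpace (PBond P i → G))
  haveI : PolishSpace (GaugeField P i G) := inferInstanceAs (PolishSpace (PBond P i → G))
  haveI : SecondCountableTopology (GaugeField P i G) := inferInstanceAs (SecondCountableTopology (PBond P i → G))
  haveI : BorelSpace (GaugeField P i G) := inferInstanceAs (BorelSpace (PBond P i → G))
  exact exists_measurable_constrained_argmin_of_continuousOn hπ hO hg hR hA U₁

end ContinuousOn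

/-! ## §2 From per-`(k, h)` measurable selectors to external inputs (abstract glue) -/

section Glue

variable {S : Scales L} {G : Type} [GaugeGroup G] [MeasurableSpace G] [HaarData G]

open Classical in
/-- **PER-`(k, h)` MEASURABLE MINIMISER SELECTORS GIVE EXTERNAL INPUTS** (the pattern of file 1b's `exists_externalInputs_measUk`, for an ARBITRARY
family of admissible sets `Adm k h V ⊆ GaugeField S.P 0 G`): if for every step `k` and history `h` there is a measurable `f` selecting a minimiser of
`A` on `Adm k h V` wherever one exists and `1` elsewhere, then there are external inputs with the same `av`, `reg` as `X₀` whose `UkH k h` (`h ≠`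
trivial) and `Uk k` are such selectors (glued at the trivial history by `ukAll`), in particular measurable for ALL `k, h`. [cite: Balaban1985UV3, (42) p.266 (bookkeeping)] -/
theorem exists_externalInputs_of_selectors (X₀ : ExternalInputs S G) (A : GaugeField S.P 0 G → ℝ)
    (Adm : (k : ℕ) → Hist S.P k → GaugeField S.P k G → Set (GaugeField S.P 0 G))
    (hsel : ∀ (k : ℕ) (h : Hist S.P k), ∃ f : GaugeField S.P k G → GaugeField S.P 0 G, Measurable f ∧
      (∀ V, (∃ U ∈ Adm k h V, IsMinOn A (Adm k h V) U) → f V ∈ Adm k h V ∧ IsMinOn A (Adm k h V) (f V)) ∧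
      (∀ V, ¬ (∃ U ∈ Adm k h V, IsMinOn A (Adm k h V) U) → f V = 1)) :
    ∃ X : ExternalInputs S G, X.av = X₀.av ∧ X.reg = X₀.reg ∧
      (∀ (k : ℕ) (h : Hist S.P k), Measurable (X.UkH k h)) ∧
      (∀ (k : ℕ) (h : Hist S.P k) (V : GaugeField S.P k G), h ≠ Hist.triv S.P k →
        (∃ U ∈ Adm k h V, IsMinOn A (Adm k h V) U) → X.UkH k h V ∈ Adm k h V ∧ IsMinOn A (Adm k h V) (X.UkH k h V)) ∧
      (∀ (k : ℕ) (V : GaugeField S.P (k + 1) G),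
        (∃ U ∈ Adm (k + 1) (Hist.triv S.P (k + 1)) V, IsMinOn A (Adm (k + 1) (Hist.triv S.P (k + 1)) V) U) →
          X.Uk k V ∈ Adm (k + 1) (Hist.triv S.P (k + 1)) V ∧ IsMinOn A (Adm (k + 1) (Hist.triv S.P (k + 1)) V) (X.Uk k V)) ∧
      (∀ (k : ℕ) (h : Hist S.P k) (V : GaugeField S.P k G), h ≠ Hist.triv S.P k →
        ¬ (∃ U ∈ Adm k h V, IsMinOn A (Adm k h V) U) → X.UkH k h V = 1) ∧
      (∀ (k : ℕ) (V : GaugeField S.P (k + 1) G),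
        ¬ (∃ U ∈ Adm (k + 1) (Hist.triv S.P (k + 1)) V, IsMinOn A (Adm (k + 1) (Hist.triv S.P (k + 1)) V) U) → X.Uk k V = 1) := by
  choose F hFm hFmin hFout using hsel
  let Uk : (k : ℕ) → GaugeField S.P (k + 1) G → GaugeField S.P 0 G := fun k => F (k + 1) (Hist.triv S.P (k + 1))
  let UkH : (k : ℕ) → Hist S.P k → GaugeField S.P k G → GaugeField S.P 0 G :=
    fun k h V => if h = Hist.triv S.P k then ukAll Uk k V else F k h V
  have htriv : ∀ (k : ℕ) (V : GaugeField S.P k G), UkH k (Hist.triv S.P k) V = ukAll Uk k V := fun k V => by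
    simp only [UkH, if_true]
  have hne : ∀ (k : ℕ) (h : Hist S.P k), h ≠ Hist.triv S.P k → UkH k h = F k h := fun k h hh => by
    funext V
    simp only [UkH, if_neg hh]
  refine ⟨{ X₀ with Uk := Uk, UkH := UkH, UkH_triv := htriv }, rfl, rfl, ?_, ?_, ?_, ?_, ?_⟩
  · intro k h
    refine measurable_ukH_of_triv Uk UkH htriv (fun k => hFm (k + 1) _) (fun k h hh => ?_) k h
    rw [hne k h hh]
    exact hFm k h
  · intro k h V hh hex
    have hval : UkH k h V = F k h V := by rw [hne k h hh]
    simp only [hval]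
    exact hFmin k h V hex
  · intro k V hex
    exact hFmin (k + 1) (Hist.triv S.P (k + 1)) V hex
  · intro k h V hh hno
    have hval : UkH k h V = F k h V := by rw [hne k h hh]
    simp only [hval]
    exact hFout k h V hno
  · intro k V hno
    exact hFout (k + 1) (Hist.triv S.P (k + 1)) V hno

end Glue

/-! ## §3 The (42)-problem the face `inB42` reads: lift averages prescribed on `Λ_j(h)`, `j < k`, inside the regular class -/

section Problem

variable {S : Scales L} {G : Type} [GaugeGroup G] [MeasurableSpace G] (𝔊 : GroupModel G) (𝔠 : AlphaConsts L 𝔊.N)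

/-- **THE (42)-PROBLEM OF STEP `k` AND HISTORY `h` AS THE FACE `inB42` READS IT**: configurations of [7]'s regular class over the `Ω_j(h)`
(`regClass 𝔊 𝔠 k h`) whose lifted `j`-fold averages (42)–(43) of [4] agree with the data `(Vl)_j` on the bonds of `Λ_j(h)`, `j < k`
(`InB42Lift`), and — WHEN `V` lies in the (open) small-field set `Sm` where print needs `U_k(V, h)` at all (the characteristic functions (40)) —
whose top-level image `T U` agrees with the current field `V` on the bonds `Bk` («V_k = V on Ω_k», through any `T`, e.g. the `k`-fold torus
average; `Sm = ∅` drops the clause, `Sm = univ` imposes it always). [cite: Balaban1985UV3, (42) p.266; Balaban1985Variational, (3)+(6)+(8) pp.278–279] -/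
def admB42 (k : ℕ) (h : Hist S.P k) (Vl : ℕ → B7Prop1Explicit.Site S.P.d → Fin S.P.d → (Matrix (Fin 𝔊.N) (Fin 𝔊.N) ℂ)ˣ)
    (Sm : Set (GaugeField S.P k G)) (T : GaugeField S.P 0 G → GaugeField S.P k G) (Bk : Set (PBond S.P k)) (V : GaugeField S.P k G) :
    Set (GaugeField S.P 0 G) :=
  {U | U ∈ regClass 𝔊 𝔠 k h ∧ InB42Lift S 𝔠.lane.carrier.M₁ (rcolOf S 𝔠.lane.carrier) h (liftCfg 𝔊 U) Vl ∧
    (V ∈ Sm → ∀ b ∈ Bk, T U b = V b)}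

/-- **MEASURABLE SELECTORS FOR THE `inB42` PROBLEM EXIST once the lift averages and `T` are continuous on the class** (in-edge b7 content, displayed):
target = (the countable product of the matrix values of the lift averages, `j < k`) × (the level-`k` field), relation = equality on the `Λ_j(h)`-bonds
and, for data in the open `Sm`, on `Bk` (closed), datum `V ↦ (Vl, V)` (measurable), class `regClass` (open, file 2); §1's selection. [cite: Balaban1985UV3, (42) p.266; Balaban1985Variational, Thm 1 p.279 (measurable-selection reading; existence NOT used)] -/
theorem exists_selector_admB42 (k : ℕ) (h : Hist S.P k)
    (Vl : ℕ → B7Prop1Explicit.Site S.P.d → Fin S.P.d → (Matrix (Fin 𝔊.N) (Fin 𝔊.N) ℂ)ˣ)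
    {Sm : Set (GaugeField S.P k G)} (hSm : letI := rhoTopology 𝔊; IsOpen Sm)
    (T : GaugeField S.P 0 G → GaugeField S.P k G) (Bk : Set (PBond S.P k))
    (hcont : letI := rhoTopology 𝔊; ∀ j < k, ∀ (z : B7Prop1Explicit.Site S.P.d) (κ : Fin S.P.d),
      projSite (((L : ℤ) ^ j) • z) ∈ Lam 𝔠.lane.carrier.M₁ (rcolOf S 𝔠.lane.carrier) h j →
      projSite (((L : ℤ) ^ j) • (z + e κ)) ∈ Lam 𝔠.lane.carrier.M₁ (rcolOf S 𝔠.lane.carrier) h j →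
      ContinuousOn (fun U : GaugeField S.P 0 G => ((avgIter L (liftCfg 𝔊 U) j z κ : (Matrix (Fin 𝔊.N) (Fin 𝔊.N) ℂ)ˣ) :
        Matrix (Fin 𝔊.N) (Fin 𝔊.N) ℂ)) (regClass 𝔊 𝔠 k h))
    (hT : letI := rhoTopology 𝔊; ContinuousOn T (regClass 𝔊 𝔠 k h))
    {A : GaugeField S.P 0 G → ℝ} (hA : letI := rhoTopology 𝔊; Continuous A) :
    ∃ f : GaugeField S.P k G → GaugeField S.P 0 G, Measurable f ∧
      (∀ V, (∃ U ∈ admB42 𝔊 𝔠 k h Vl Sm T Bk V, IsMinOn A (admB42 𝔊 𝔠 k h Vl Sm T Bk V) U) →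
        f V ∈ admB42 𝔊 𝔠 k h Vl Sm T Bk V ∧ IsMinOn A (admB42 𝔊 𝔠 k h Vl Sm T Bk V) (f V)) ∧
      (∀ V, ¬ (∃ U ∈ admB42 𝔊 𝔠 k h Vl Sm T Bk V, IsMinOn A (admB42 𝔊 𝔠 k h Vl Sm T Bk V) U) → f V = 1) := by
  classical
  letI := rhoTopology 𝔊
  haveI := secondCountableTopology_rho 𝔊
  haveI := borelSpace_rho 𝔊
  haveI : T2Space G := (isEmbedding_rho 𝔊).t2Space
  haveI : SecondCountableTopology (GaugeField S.P k G) := inferInstanceAs (SecondCountableTopology (PBond S.P k → G))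
  haveI : BorelSpace (GaugeField S.P k G) := inferInstanceAs (BorelSpace (PBond S.P k → G))
  -- the target: matrix values of the lift averages (Borel), times the level-`k` field
  letI : MeasurableSpace (Matrix (Fin 𝔊.N) (Fin 𝔊.N) ℂ) := borel _
  haveI : BorelSpace (Matrix (Fin 𝔊.N) (Fin 𝔊.N) ℂ) := ⟨rfl⟩
  haveI : SecondCountableTopology (Matrix (Fin 𝔊.N) (Fin 𝔊.N) ℂ) := secondCountableTopology_matrix (n := Fin 𝔊.N)
  haveI : SecondCountableTopology (B7Prop1Explicit.Site S.P.d → Fin S.P.d → Matrix (Fin 𝔊.N) (Fin 𝔊.N) ℂ) := inferInstance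
  haveI : SecondCountableTopology (Fin k → B7Prop1Explicit.Site S.P.d → Fin S.P.d → Matrix (Fin 𝔊.N) (Fin 𝔊.N) ℂ) := inferInstance
  haveI : BorelSpace (Fin k → B7Prop1Explicit.Site S.P.d → Fin S.P.d → Matrix (Fin 𝔊.N) (Fin 𝔊.N) ℂ) := inferInstance
  -- cut the instance search on the product target (the double product otherwise exhausts the synthesiser)
  letI instTZ : TopologicalSpace ((Fin k → B7Prop1Explicit.Site S.P.d → Fin S.P.d → Matrix (Fin 𝔊.N) (Fin 𝔊.N) ℂ) × GaugeField S.P k G) := inferInstance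
  letI instMZ : MeasurableSpace ((Fin k → B7Prop1Explicit.Site S.P.d → Fin S.P.d → Matrix (Fin 𝔊.N) (Fin 𝔊.N) ℂ) × GaugeField S.P k G) := inferInstance
  haveI : OpensMeasurableSpace ((Fin k → B7Prop1Explicit.Site S.P.d → Fin S.P.d → Matrix (Fin 𝔊.N) (Fin 𝔊.N) ℂ) × GaugeField S.P k G) := inferInstance
  letI : TopologicalSpace (((Fin k → B7Prop1Explicit.Site S.P.d → Fin S.P.d → Matrix (Fin 𝔊.N) (Fin 𝔊.N) ℂ) × GaugeField S.P k G) × ((Fin k → B7Prop1Explicit.Site S.P.d → Fin S.P.d → Matrix (Fin 𝔊.N) (Fin 𝔊.N) ℂ) × GaugeField S.P k G)) := inferInstance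
  let g : GaugeField S.P 0 G → ((Fin k → B7Prop1Explicit.Site S.P.d → Fin S.P.d → Matrix (Fin 𝔊.N) (Fin 𝔊.N) ℂ) × GaugeField S.P k G) :=
    fun U => (fun j z κ =>
      if projSite (((L : ℤ) ^ (j : ℕ)) • z) ∈ Lam 𝔠.lane.carrier.M₁ (rcolOf S 𝔠.lane.carrier) h j ∧
          projSite (((L : ℤ) ^ (j : ℕ)) • (z + e κ)) ∈ Lam 𝔠.lane.carrier.M₁ (rcolOf S 𝔠.lane.carrier) h j
      then ((avgIter L (liftCfg 𝔊 U) (j : ℕ) z κ : (Matrix (Fin 𝔊.N) (Fin 𝔊.N) ℂ)ˣ) : Matrix (Fin 𝔊.N) (Fin 𝔊.N) ℂ) else 0, T U)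
  let π : GaugeField S.P k G → ((Fin k → B7Prop1Explicit.Site S.P.d → Fin S.P.d → Matrix (Fin 𝔊.N) (Fin 𝔊.N) ℂ) × GaugeField S.P k G) := fun V => (fun j z κ => ((Vl (j : ℕ) z κ : (Matrix (Fin 𝔊.N) (Fin 𝔊.N) ℂ)ˣ) : Matrix (Fin 𝔊.N) (Fin 𝔊.N) ℂ), V)
  let R₁ : Set (((Fin k → B7Prop1Explicit.Site S.P.d → Fin S.P.d → Matrix (Fin 𝔊.N) (Fin 𝔊.N) ℂ) × GaugeField S.P k G) × ((Fin k → B7Prop1Explicit.Site S.P.d → Fin S.P.d → Matrix (Fin 𝔊.N) (Fin 𝔊.N) ℂ) × GaugeField S.P k G)) := {p | ∀ (j : Fin k) (z : B7Prop1Explicit.Site S.P.d) (κ : Fin S.P.d),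
      projSite (((L : ℤ) ^ (j : ℕ)) • z) ∈ Lam 𝔠.lane.carrier.M₁ (rcolOf S 𝔠.lane.carrier) h j →
      projSite (((L : ℤ) ^ (j : ℕ)) • (z + e κ)) ∈ Lam 𝔠.lane.carrier.M₁ (rcolOf S 𝔠.lane.carrier) h j →
        p.1.1 j z κ = p.2.1 j z κ}
  let R₂ : Set (((Fin k → B7Prop1Explicit.Site S.P.d → Fin S.P.d → Matrix (Fin 𝔊.N) (Fin 𝔊.N) ℂ) × GaugeField S.P k G) × ((Fin k → B7Prop1Explicit.Site S.P.d → Fin S.P.d → Matrix (Fin 𝔊.N) (Fin 𝔊.N) ℂ) × GaugeField S.P k G)) := {p | p.2.2 ∈ Sm → ∀ b ∈ Bk, p.1.2 b = p.2.2 b}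
  let R : Set (((Fin k → B7Prop1Explicit.Site S.P.d → Fin S.P.d → Matrix (Fin 𝔊.N) (Fin 𝔊.N) ℂ) × GaugeField S.P k G) × ((Fin k → B7Prop1Explicit.Site S.P.d → Fin S.P.d → Matrix (Fin 𝔊.N) (Fin 𝔊.N) ℂ) × GaugeField S.P k G)) := R₁ ∩ R₂
  have hπ : Measurable π := measurable_const.prodMk measurable_id
  have hg : ContinuousOn g (regClass 𝔊 𝔠 k h) := by
    refine ContinuousOn.prodMk ?_ hT
    refine continuousOn_pi.mpr fun j => continuousOn_pi.mpr fun z => continuousOn_pi.mpr fun κ => ?_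
    by_cases hc : projSite (((L : ℤ) ^ (j : ℕ)) • z) ∈ Lam 𝔠.lane.carrier.M₁ (rcolOf S 𝔠.lane.carrier) h j ∧
        projSite (((L : ℤ) ^ (j : ℕ)) • (z + e κ)) ∈ Lam 𝔠.lane.carrier.M₁ (rcolOf S 𝔠.lane.carrier) h j
    · simp only [if_pos hc]
      exact hcont j j.2 z κ hc.1 hc.2
    · simp only [if_neg hc]
      exact continuousOn_const
  have hcoordl : ∀ (j : Fin k) (z : B7Prop1Explicit.Site S.P.d) (κ : Fin S.P.d), Continuous fun p : ((Fin k → B7Prop1Explicit.Site S.P.d → Fin S.P.d → Matrix (Fin 𝔊.N) (Fin 𝔊.N) ℂ) × GaugeField S.P k G) => p.1 j z κ :=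
    fun j z κ => (continuous_apply κ).comp ((continuous_apply z).comp ((continuous_apply j).comp continuous_fst))
  have hcoordk : ∀ b : PBond S.P k, Continuous fun p : ((Fin k → B7Prop1Explicit.Site S.P.d → Fin S.P.d → Matrix (Fin 𝔊.N) (Fin 𝔊.N) ℂ) × GaugeField S.P k G) => p.2 b :=
    fun b => (show Continuous fun V : GaugeField S.P k G => V b from continuous_apply b).comp continuous_snd
  have hR₁ : IsClosed R₁ := by
    simp only [R₁, setOf_forall]
    refine isClosed_iInter fun j => isClosed_iInter fun z => isClosed_iInter fun κ => isClosed_iInter fun _ => isClosed_iInter fun _ => ?_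
    exact isClosed_eq ((hcoordl j z κ).comp continuous_fst) ((hcoordl j z κ).comp continuous_snd)
  have hR₂ : IsClosed R₂ := by
    have hset : R₂ = {p : ((Fin k → B7Prop1Explicit.Site S.P.d → Fin S.P.d → Matrix (Fin 𝔊.N) (Fin 𝔊.N) ℂ) × GaugeField S.P k G) × ((Fin k → B7Prop1Explicit.Site S.P.d → Fin S.P.d → Matrix (Fin 𝔊.N) (Fin 𝔊.N) ℂ) × GaugeField S.P k G) | p.2.2 ∉ Sm} ∪ ⋂ b ∈ Bk, {p | p.1.2 b = p.2.2 b} := by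
      ext p
      simp only [R₂, mem_setOf_eq, mem_union, mem_iInter]
      exact ⟨fun hp => (em (p.2.2 ∈ Sm)).elim (fun hs => Or.inr (hp hs)) Or.inl, fun hp hs => hp.elim (fun hn => absurd hs hn) id⟩
    rw [hset]
    refine IsClosed.union ?_ (isClosed_biInter fun b _ => isClosed_eq ((hcoordk b).comp continuous_fst) ((hcoordk b).comp continuous_snd))
    exact (hSm.isClosed_compl).preimage (continuous_snd.comp continuous_snd)
  have hR : IsClosed R := hR₁.inter hR₂
  have hadm : ∀ (U : GaugeField S.P 0 G) (V : GaugeField S.P k G), (U ∈ regClass 𝔊 𝔠 k h ∧ (g U, π V) ∈ R) ↔ U ∈ admB42 𝔊 𝔠 k h Vl Sm T Bk V := by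
    intro U V
    simp only [admB42, mem_setOf_eq, R, R₁, R₂, mem_inter_iff, g, π, InB42Lift]
    constructor
    · rintro ⟨hU, hl, hk⟩
      refine ⟨hU, fun j hj z κ h1 h2 => ?_, hk⟩
      have h' := hl ⟨j, hj⟩ z κ h1 h2
      rw [if_pos ⟨h1, h2⟩] at h'
      exact Units.val_injective h'
    · rintro ⟨hU, hl, hk⟩
      refine ⟨hU, fun j z κ h1 h2 => ?_, hk⟩
      rw [if_pos ⟨h1, h2⟩]
      exact congrArg Units.val (hl j j.2 z κ h1 h2)
  obtain ⟨f, hfm, hfin, hfout⟩ :=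
    exists_measurable_constrainedMin_rho_of_continuousOn 𝔊 (i := 0) hπ (isOpen_regClass 𝔊 𝔠 k h) hg hR hA 1
  refine ⟨f, hfm, fun V hV => ?_, fun V hV => ?_⟩
  · obtain ⟨U₀, hU₀, hmin⟩ := hV
    have hex : ∃ U, (U ∈ regClass 𝔊 𝔠 k h ∧ (g U, π V) ∈ R) ∧ ∀ U', U' ∈ regClass 𝔊 𝔠 k h ∧ (g U', π V) ∈ R → A U ≤ A U' :=
      ⟨U₀, (hadm U₀ V).mpr hU₀, fun U' hU' => hmin ((hadm U' V).mp hU')⟩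
    obtain ⟨hf₁, hf₂⟩ := hfin V hex
    exact ⟨(hadm (f V) V).mp hf₁, fun U' hU' => hf₂ U' ((hadm U' V).mpr hU')⟩
  · refine hfout V fun h' => hV ?_
    obtain ⟨U₀, hU₀, hmin⟩ := h'
    exact ⟨U₀, (hadm U₀ V).mp hU₀, fun U' hU' => hmin U' ((hadm U' V).mpr hU')⟩

end Problem

/-! ## §4 The END of the reduction: `InEdgeFaces₃` from the in-edge conclusions (b7) continuity and (b11) solvability -/

section End

variable {S : Scales L} {G : Type} [GaugeGroup G] [MeasurableSpace G] [HaarData G] (𝔊 : GroupModel G) (𝔠 : AlphaConsts L 𝔊.N)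

/-- **★ `InEdgeFaces₃` FROM TWO IN-EDGE CONCLUSIONS.**  Data: external inputs `X₀` (for `av`, `reg`), a continuous objective `A` (e.g. `A^η`),
`h`-LARGE lift data `Vl k h` (`HLarge`: the field history the constraint (42) prescribes on the `Λ_j(h)`, p. 273 L13), open small-field sets
`Sm k h` (where the top clause is imposed), top-level maps `T k` and bonds `Bk k h`.  Hypotheses DISPLAYED: (b7) `hcont`∕`hT` — the lifted `j`-fold averages of [4] at the bonds of `Λ_j(h)`, `j < k`, and `T k` are continuous on [7]'s
regular class in the topology of the realisation; (b11) `hsolv` — for `k ≤ K`, admissible `h` and every `V`, (42) has a minimiser of `A` in the class.  Conclusion: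
external inputs `X` (same `av`, `reg`) whose `U_k(·, h)` are measurable (42)-minimiser selections with (i) `measUk` for all `k, h`, (ii) `reg2` for all
`k ≤ K`, (iii) `inB42`, (iv) hence `InEdgeFaces₃ 𝔊 𝔠 X` — the in-edge schema from which gen 2∕3 derive `RunAlpha` and N08 at the record given the
DATA schema. [cite: Balaban1985UV3, (42) p.266 + (67)–(68) p.273; Balaban1985Variational, (2)+(3)+(8) pp.278–279, Thm 1 p.279; Balaban1985Averaging, (42)–(43) pp.23–24] -/
theorem exists_externalInputs_faces₃ (X₀ : ExternalInputs S G) {A : GaugeField S.P 0 G → ℝ} (hA : letI := rhoTopology 𝔊; Continuous A)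
    (Vl : (k : ℕ) → Hist S.P k → ℕ → B7Prop1Explicit.Site S.P.d → Fin S.P.d → (Matrix (Fin 𝔊.N) (Fin 𝔊.N) ℂ)ˣ)
    (hVl : ∀ (k : ℕ) (h : Hist S.P k), HLarge S 𝔠.lane.carrier.b₀ 𝔠.lane.carrier.p₀ h (Vl k h))
    (Sm : (k : ℕ) → Hist S.P k → Set (GaugeField S.P k G)) (hSm : letI := rhoTopology 𝔊; ∀ k h, IsOpen (Sm k h))
    (T : (k : ℕ) → GaugeField S.P 0 G → GaugeField S.P k G) (Bk : (k : ℕ) → Hist S.P k → Set (PBond S.P k))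
    (hcont : letI := rhoTopology 𝔊; ∀ (k : ℕ) (h : Hist S.P k), ∀ j < k, ∀ (z : B7Prop1Explicit.Site S.P.d) (κ : Fin S.P.d),
      projSite (((L : ℤ) ^ j) • z) ∈ Lam 𝔠.lane.carrier.M₁ (rcolOf S 𝔠.lane.carrier) h j →
      projSite (((L : ℤ) ^ j) • (z + e κ)) ∈ Lam 𝔠.lane.carrier.M₁ (rcolOf S 𝔠.lane.carrier) h j →
      ContinuousOn (fun U : GaugeField S.P 0 G => ((avgIter L (liftCfg 𝔊 U) j z κ : (Matrix (Fin 𝔊.N) (Fin 𝔊.N) ℂ)ˣ) :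
        Matrix (Fin 𝔊.N) (Fin 𝔊.N) ℂ)) (regClass 𝔊 𝔠 k h))
    (hT : letI := rhoTopology 𝔊; ∀ (k : ℕ) (h : Hist S.P k), ContinuousOn (T k) (regClass 𝔊 𝔠 k h))
    (hsolv : ∀ k, k ≤ S.K → ∀ (h : Hist S.P k), Hist.Admissible 𝔠.lane.carrier.M₁ (rcolOf S 𝔠.lane.carrier) k h →
      ∀ (V : GaugeField S.P k G), ∃ U ∈ admB42 𝔊 𝔠 k h (Vl k h) (Sm k h) (T k) (Bk k h) V, IsMinOn A (admB42 𝔊 𝔠 k h (Vl k h) (Sm k h) (T k) (Bk k h) V) U) :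
    ∃ X : ExternalInputs S G, X.av = X₀.av ∧ X.reg = X₀.reg ∧
      (∀ (k : ℕ) (h : Hist S.P k), Measurable (X.UkH k h)) ∧
      (∀ k, k ≤ S.K → ∀ (h : Hist S.P k) (U : GaugeField S.P k G), ∀ j < k,
        RegLift S j (Omega 𝔠.lane.carrier.M₁ (rcolOf S 𝔠.lane.carrier) k h j)
          (𝔠.C68 * (S.gk j * pFun 𝔠.lane.carrier.b₀ 𝔠.lane.carrier.p₀ (S.gk j))) (liftCfg 𝔊 (X.UkH k h U))) ∧
      (∀ k, k ≤ S.K → ∀ (h : Hist S.P k), Hist.Admissible 𝔠.lane.carrier.M₁ (rcolOf S 𝔠.lane.carrier) k h → h ≠ Hist.triv S.P k →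
        ∀ (U : GaugeField S.P k G), X.UkH k h U ∈ admB42 𝔊 𝔠 k h (Vl k h) (Sm k h) (T k) (Bk k h) U ∧
          IsMinOn A (admB42 𝔊 𝔠 k h (Vl k h) (Sm k h) (T k) (Bk k h) U) (X.UkH k h U)) ∧
      (∀ k, k + 1 ≤ S.K → Hist.Admissible 𝔠.lane.carrier.M₁ (rcolOf S 𝔠.lane.carrier) (k + 1) (Hist.triv S.P (k + 1)) →
        ∀ (U : GaugeField S.P (k + 1) G),
          X.Uk k U ∈ admB42 𝔊 𝔠 (k + 1) (Hist.triv S.P (k + 1)) (Vl (k + 1) (Hist.triv S.P (k + 1))) (Sm (k + 1) (Hist.triv S.P (k + 1))) (T (k + 1))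
              (Bk (k + 1) (Hist.triv S.P (k + 1))) U ∧
            IsMinOn A (admB42 𝔊 𝔠 (k + 1) (Hist.triv S.P (k + 1)) (Vl (k + 1) (Hist.triv S.P (k + 1))) (Sm (k + 1) (Hist.triv S.P (k + 1))) (T (k + 1))
              (Bk (k + 1) (Hist.triv S.P (k + 1))) U) (X.Uk k U)) ∧
      InEdgeFaces₃ 𝔊 𝔠 X := by
  obtain ⟨X, hav, hreg, hm, hmin, hminT, hout, houtT⟩ := exists_externalInputs_of_selectors X₀ A
    (fun k h V => admB42 𝔊 𝔠 k h (Vl k h) (Sm k h) (T k) (Bk k h) V)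
    (fun k h => exists_selector_admB42 𝔊 𝔠 k h (Vl k h) (hSm k h) (T k) (Bk k h) (hcont k h) (hT k h) hA)
  -- (ii) every value lies in the regular class: a minimiser in the class, or `1`
  have hval : ∀ k, k ≤ S.K → ∀ (h : Hist S.P k) (U : GaugeField S.P k G), X.UkH k h U ∈ regClass 𝔊 𝔠 k h := by
    intro k hk h U
    by_cases hh : h = Hist.triv S.P k
    · subst hh
      rw [X.UkH_triv]
      cases k with
      | zero => exact fun j hj => absurd hj (Nat.not_lt_zero j)
      | succ k =>
        show X.Uk k U ∈ regClass 𝔊 𝔠 (k + 1) (Hist.triv S.P (k + 1))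
        by_cases hex : ∃ U' ∈ admB42 𝔊 𝔠 (k + 1) (Hist.triv S.P (k + 1)) (Vl (k + 1) (Hist.triv S.P (k + 1))) (Sm (k + 1) (Hist.triv S.P (k + 1))) (T (k + 1))
            (Bk (k + 1) (Hist.triv S.P (k + 1))) U,
            IsMinOn A (admB42 𝔊 𝔠 (k + 1) (Hist.triv S.P (k + 1)) (Vl (k + 1) (Hist.triv S.P (k + 1))) (Sm (k + 1) (Hist.triv S.P (k + 1))) (T (k + 1))
              (Bk (k + 1) (Hist.triv S.P (k + 1))) U) U'
        · exact (hminT k U hex).1.1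
        · rw [houtT k U hex]
          exact one_mem_regClass 𝔊 𝔠 (k + 1) hk _
    · by_cases hex : ∃ U' ∈ admB42 𝔊 𝔠 k h (Vl k h) (Sm k h) (T k) (Bk k h) U, IsMinOn A (admB42 𝔊 𝔠 k h (Vl k h) (Sm k h) (T k) (Bk k h) U) U'
      · exact (hmin k h U hh hex).1.1
      · rw [hout k h U hh hex]
        exact one_mem_regClass 𝔊 𝔠 k hk h
  have hreg2 : ∀ k, k ≤ S.K → ∀ (h : Hist S.P k) (U : GaugeField S.P k G), ∀ j < k,
      RegLift S j (Omega 𝔠.lane.carrier.M₁ (rcolOf S 𝔠.lane.carrier) k h j)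
        (𝔠.C68 * (S.gk j * pFun 𝔠.lane.carrier.b₀ 𝔠.lane.carrier.p₀ (S.gk j))) (liftCfg 𝔊 (X.UkH k h U)) :=
    fun k hk h U j hj => hval k hk h U j hj
  -- (iii) on admissible histories the problem is solvable (b11), so the value IS a minimiser in `admB42`
  have hsolN : ∀ k, k ≤ S.K → ∀ (h : Hist S.P k), Hist.Admissible 𝔠.lane.carrier.M₁ (rcolOf S 𝔠.lane.carrier) k h →
      h ≠ Hist.triv S.P k → ∀ (U : GaugeField S.P k G), X.UkH k h U ∈ admB42 𝔊 𝔠 k h (Vl k h) (Sm k h) (T k) (Bk k h) U ∧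
        IsMinOn A (admB42 𝔊 𝔠 k h (Vl k h) (Sm k h) (T k) (Bk k h) U) (X.UkH k h U) :=
    fun k hk h hh ht U => hmin k h U ht (hsolv k hk h hh U)
  have hsolT : ∀ k, k + 1 ≤ S.K → Hist.Admissible 𝔠.lane.carrier.M₁ (rcolOf S 𝔠.lane.carrier) (k + 1) (Hist.triv S.P (k + 1)) →
      ∀ (U : GaugeField S.P (k + 1) G),
        X.Uk k U ∈ admB42 𝔊 𝔠 (k + 1) (Hist.triv S.P (k + 1)) (Vl (k + 1) (Hist.triv S.P (k + 1))) (Sm (k + 1) (Hist.triv S.P (k + 1))) (T (k + 1))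
            (Bk (k + 1) (Hist.triv S.P (k + 1))) U ∧
          IsMinOn A (admB42 𝔊 𝔠 (k + 1) (Hist.triv S.P (k + 1)) (Vl (k + 1) (Hist.triv S.P (k + 1))) (Sm (k + 1) (Hist.triv S.P (k + 1))) (T (k + 1))
            (Bk (k + 1) (Hist.triv S.P (k + 1))) U) (X.Uk k U) :=
    fun k hk hh U => hminT k U (hsolv (k + 1) hk _ hh U)
  -- (iv) the face `inB42` with the witness `Vl k h`, and the schema
  have h42 : ∀ k, k ≤ S.K → ∀ (h : Hist S.P k), Hist.Admissible 𝔠.lane.carrier.M₁ (rcolOf S 𝔠.lane.carrier) k h →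
      ∀ (U : GaugeField S.P k G), ∃ V : ℕ → B7Prop1Explicit.Site S.P.d → Fin S.P.d → (Matrix (Fin 𝔊.N) (Fin 𝔊.N) ℂ)ˣ,
        HLarge S 𝔠.lane.carrier.b₀ 𝔠.lane.carrier.p₀ h V ∧
          InB42Lift S 𝔠.lane.carrier.M₁ (rcolOf S 𝔠.lane.carrier) h (liftCfg 𝔊 (X.UkH k h U)) V := by
    intro k hk h hh U
    refine ⟨Vl k h, hVl k h, ?_⟩
    by_cases ht : h = Hist.triv S.P k
    · subst ht
      cases k with
      | zero => exact fun j hj => absurd hj (Nat.not_lt_zero j)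
      | succ k =>
        rw [X.UkH_triv]
        exact (hsolT k hk hh U).1.2.1
    · exact (hsolN k hk h hh ht U).1.2.1
  exact ⟨X, hav, hreg, hm, hreg2, hsolN, hsolT, inEdgeFaces₃_of_inB42 𝔊 𝔠 X hm hreg2 h42⟩

end End

end Summit.QuantumFields.YangMills.Theorems.BalabanUVNodesN08AlphaInB42Sel

end
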